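import Literature.Topology.PlanarFoliations.PolygonLeafPath
import Literature.Topology.PlaneTopology.JordanNesting
import HarnessLib

/-!
# Pattern cycles: simple separatrix polygons as packaged data, their fill

Topic: Topology / PlanarFoliations, sequel to `WalkBuild.lean`, `PolygonLoop.lean`,
`PolygonLeafPath.lean`. The minimiser scheme of the graph case of Novikov's vanishing-cycle
theorem quantifies over **all** simple separatrix polygons in a compact set `C`; we package the
data of such a polygon as a structure `PolyCycle D hbi C` (punctures `vtx`, separatrix leaves
`sx` — open leaves in `C` from `vtx i` to `vtx (i + 1)` — distinct punctures, distinct leaves) and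
re-export the constructions: the junctions and links of its walk (`PolyCycle.J`, `PolyCycle.ℓ`),
its **Jordan loop** `PolyCycle.loop` (`isJordanLoop_loop`), its **fill** `fill = range ∪ inside`
(compact, with frontier in the loop, containing the punctures `vtx i`), its **leaf loop** under
`g` (essential = not null-homotopic; stated inline by consumers, no named predicate).

## References

* C. Camacho, A. Lins Neto, *Geometric Theory of Foliations*, Birkhäuser (1985), Ch. VII §2
  [CamachoLinsNeto1985].
-/

noncomputable section

open Set Filter Function Metric unitInterval
open _root_.Topology
open Literature.Topology.FourManifolds Literature.Topology.FourManifolds.Foliation Literature.Topology.PlaneTopology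

namespace Literature.Topology.PlanarFoliations

variable {X : Type*} [TopologicalSpace X] [T2Space X] [SecondCountableTopology X] [Nonempty X] {F : Foliation ℝ X} {ι : X → ℂ}
variable {B : Type*} [NormedAddCommGroup B] {M : Type*} [TopologicalSpace M] {T : Foliation B M} {g : ℂ → M}

namespace StarData

/-- **A simple separatrix polygon** of star data in the compact set `C`: `m ≥ 1` distinct
punctures `vtx i` and distinct open leaves `sx i` in `C`, the leaf of `sx i` running from
`vtx (i - 1)` to `vtx i` (`α`- and `ω`-limit sets). [folklore] -/
structure PolyCycle (D : StarData F ι T g) (hbi : IsBiOriented F) (C : Set ℂ) where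
  /-- the number of separatrices -/
  m : ℕ
  [neZero : NeZero m]
  /-- the punctures -/
  vtx : Fin m → ℂ
  /-- base points of the separatrix leaves -/
  sx : Fin m → X
  nc : ∀ i, NoncompactSpace (F.Leaf (sx i))
  hv : ∀ i, vtx i ∈ D.P
  hmem : ∀ i, ∀ q : F.Leaf (sx i), ι (Leaf.pt q) ∈ C
  hω : ∀ i, (haveI := nc i; omegaSet hbi ι (sx i) = {vtx i})
  hα : ∀ i, (haveI := nc (i + 1); alphaSet hbi ι (sx (i + 1)) = {vtx i})
  hvtx : Injective vtx
  hsx : ∀ a b, F.leaf (sx a) = F.leaf (sx b) → a = b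

namespace PolyCycle

variable {D : StarData F ι T g} {hbi : IsBiOriented F} {C : Set ℂ} (Z : D.PolyCycle hbi C) (hι : IsOpenEmbedding ι) (hC : IsCompact C)

/-- A polygon has at least one separatrix. [folklore] -/
instance instNeZero : NeZero Z.m := Z.neZero

/-- The separatrix leaves of a polygon are open, in their leaf topology. [folklore] -/
instance instNoncompactSpace (i : Fin Z.m) : NoncompactSpace (F.Leaf (Z.sx i)) := Z.nc i

omit [Nonempty X] in
/-- The ω-limit sets, with the canonical instances. [folklore] -/
theorem omega (i : Fin Z.m) : omegaSet hbi ι (Z.sx i) = {Z.vtx i} := Z.hω i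

omit [Nonempty X] in
/-- The α-limit sets, with the canonical instances. [folklore] -/
theorem alpha (i : Fin Z.m) : alphaSet hbi ι (Z.sx (i + 1)) = {Z.vtx i} := Z.hα i

/-- **The junctions of the walk around the polygon.** [folklore] -/
def J : ℕ → D.WalkJunction hι := D.walkJ hι hC Z.hv Z.hmem Z.omega Z.alpha

/-- **The links of the walk around the polygon.** [folklore] -/
def ℓ (k : ℕ) : Path (Z.J hι hC k).Kout.base (Z.J hι hC (k + 1)).Kin.base := D.walkℓ hι hC Z.hv Z.hmem Z.omega Z.alpha k

/-- The walk closes up after `m` steps. [folklore] -/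
theorem J_period : Z.J hι hC Z.m = Z.J hι hC 0 := D.walkJ_period hι hC Z.hv Z.hmem Z.omega Z.alpha

/-- The links are continuous in the leaf topology. [folklore] -/
theorem continuous_toLeafSpace_ℓ (k : ℕ) : Continuous (toLeafSpace ∘ Z.ℓ hι hC k : I → F.LeafSpace) :=
  D.continuous_toLeafSpace_walkℓ hι hC Z.hv Z.hmem Z.omega Z.alpha k

/-- **The Jordan loop of the polygon.** [folklore] -/
def loop : ℝ → ℂ := D.polyLoop hι hC Z.hv Z.hmem Z.omega Z.alpha

/-- **The polygon is a Jordan loop.** [cite: CamachoLinsNeto1985, Ch. VII §2] -/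
theorem isJordanLoop_loop : IsJordanLoop (Z.loop hι hC) := D.isJordanLoop_polyLoop hι hC Z.hv Z.hmem Z.omega Z.alpha Z.hvtx Z.hsx

/-- **The fill of the polygon**: the curve together with its inside (a closed disc). [folklore] -/
def fill : Set ℂ := range (Z.loop hι hC) ∪ IsJordanLoop.inside (Z.loop hι hC)

/-- The fill is the closure of the inside. [folklore] -/
theorem fill_eq_closure_inside : Z.fill hι hC = closure (IsJordanLoop.inside (Z.loop hι hC)) := by
  rw [fill, (Z.isJordanLoop_loop hι hC).closure_inside_eq, union_comm]

/-- The fill is compact. [folklore] -/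
theorem isCompact_fill : IsCompact (Z.fill hι hC) := by
  rw [fill_eq_closure_inside]; exact (Z.isJordanLoop_loop hι hC).isCompact_closure_inside

/-- The fill is closed. [folklore] -/
theorem isClosed_fill : IsClosed (Z.fill hι hC) := (Z.isCompact_fill hι hC).isClosed

/-- The curve is in the fill. [folklore] -/
theorem range_subset_fill : range (Z.loop hι hC) ⊆ Z.fill hι hC := subset_union_left

/-- The inside is in the fill. [folklore] -/
theorem inside_subset_fill : IsJordanLoop.inside (Z.loop hι hC) ⊆ Z.fill hι hC := subset_union_right

/-- The frontier of the fill is in the curve. [folklore] -/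
theorem frontier_fill_subset : frontier (Z.fill hι hC) ⊆ range (Z.loop hι hC) := by
  rw [fill_eq_closure_inside]
  exact (frontier_closure_subset).trans (Z.isJordanLoop_loop hι hC).frontier_inside.subset

/-- The complement of the fill is the outside. [folklore] -/
theorem compl_fill : (Z.fill hι hC)ᶜ = IsJordanLoop.outside (Z.loop hι hC) := by
  ext z
  simp only [fill, mem_compl_iff, mem_union, not_or]
  constructor
  · rintro ⟨h1, h2⟩; exact (IsJordanLoop.mem_outside_iff_not_mem_inside h1).2 h2
  · intro h; exact ⟨IsJordanLoop.outside_subset_compl_range h, fun h' ↦ disjoint_left.1 IsJordanLoop.disjoint_inside_outside h' h⟩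

/-- **The punctures of the polygon are on the curve.** [folklore] -/
theorem vtx_mem_range (i : Fin Z.m) : Z.vtx i ∈ range (Z.loop hι hC) :=
  D.vtx_mem_range_polyLoop hι hC Z.hv Z.hmem Z.omega Z.alpha i

/-- The punctures of the polygon are in the fill. [folklore] -/
theorem vtx_mem_fill (i : Fin Z.m) : Z.vtx i ∈ Z.fill hι hC := Z.range_subset_fill hι hC (Z.vtx_mem_range hι hC i)

/-- **The leaf loop of the polygon** under `g`, in the leaf space of `T`. [folklore] -/
def leafLoop : Path (toLeafSpace (g (Z.vtx (idx Z.m 0))) : T.LeafSpace) (toLeafSpace (g (Z.vtx (idx Z.m 0)))) :=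
  D.polyLeafLoop hι hC Z.hv Z.hmem Z.omega Z.alpha

end PolyCycle

end StarData

end Literature.Topology.PlanarFoliations
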